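import Mathlib
import HarnessLib
import Literature.MathematicalPhysics.QuantumLattice.GrassmannWeightedEffectiveActionTruncationDB
import Literature.MathematicalPhysics.QuantumLattice.GrassmannEffectiveActionBoundDB
import Literature.MathematicalPhysics.QuantumLattice.HubbardResummedCovarianceDetBound
import Summits.HubbardSuperconductivity.HubbardSuperconductivity.Theorems.KLProgrammeKLRegimeEngineScaleZeroTwoLegTadpoleSupport
import Summits.HubbardSuperconductivity.HubbardSuperconductivity.Theorems.KLProgrammeKLRegimeEngineScaleZeroResummedCovariance
import Summits.HubbardSuperconductivity.HubbardSuperconductivity.Theorems.KLProgrammeKLRegimeEngineScaleZeroResummedDecayNormal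

/-!
# K3 engine (gen-6 item `KLRegimeEngineV16`, stmt-HubbardSuperconductivity-20236), stub `stub_twoLeg_scale0` under (ρ2): the pinned GRID SUMS
# of the two-leg kernel of the K-RESUMMED scale-`0` step `effAction C̃ V_N` — generic in `C̃`, and BY NAME at the engine's package

Cell gate-hubbard-kl, seat p3 g8 (the resummed twins of p3 g7's `…EngineScaleZeroTwoLegGridSums`).  In the K-resummed representation
(k3c5-p1: `…TwoLegResummedChain`, on the tube `Σ_0 − K∘p = Σ^{res}_0 = selfEnergy (effAction C̃ V_U)`) the scale-`0` step runs on the grid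
covariance `C̃_g = S_Nᵀ·normalCovariance Ψ̃·S_N` with the vertex `V_N` ALONE — no counterterm vertex, no diagonal tadpole bookkeeping beyond
`e^{Δ_C} V_N`.  The consumer (p1b's curve/tube-keyed CoreTD closers via `…TwoLegMomentsFromGrid`) reads pinned grid sums of
`kernel₂ (effAction C̃_g V_N)`:

* (§1, ANY grid covariance `C`) **`resummedTwoLeg_plain_sum_le_of_gridStep`** — `Σ_{Y : Y 0 = w} ‖kernel₂ (effAction C V_N) Y‖ ≤ ρ⁻²·e‖V_N‖_h/(1−θ)`
  from the determinant-bounded step with the quartic-only profile `N(2) = |U||β|/N` (`sum_norm_kernel_hubbardGridInteraction_le`);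
  **`resummedTwoLeg_offDiag_wsum_le_of_wgridStep`** — for a tree weight `wt` and a pair weight `ω ≤ c·wt` vanishing on the grid diagonal:
  `Σ ω·‖kernel₂ (effAction C V_N)‖ ≤ c·ρ⁻²·e‖V_N‖_{h,wt}·θ_w/(1−θ_w)` (weighted TRUNCATED step; off the diagonal `kernel₂ (e^{Δ_C} V_N) = 0`,
  `kernel_two_gaussConv_hubbardGridInteraction_eq_zero_of_ne`, so one more `θ_w = O(U)` is gained);
* (§2, by name) **`resummedTwoLeg_plain_sum_scaleZero_le_of_klEng`** — under the binders of `stub_twoLeg_scale0` (`FrameOK R U Nsc μ K`, `R.WF`,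
  `klBetaMin ≤ β`, `0 < U ≤ klEngU₀3 P R c`, `klEngL₃ β U ≤ L`, `klEngM₃ β U L ≤ M`), on the `4M` grid, with `κ = ρ = κ̃ = √(2(7 + (2·1606732 + 5/4)))`
  (k3c5-p1's `isGramBoundedR_scaleZero_resummed_of_frameOK`) and `α̃ = 2·(N/β)·klScaleZeroA0` (`rowSum_gridSub_resummedNormalCov_le_of_klEng`):
  `θ̃ ≤ 2^86·U ≤ 2^{-34}` and `Σ_{Y : Y 0 = w} ‖kernel₂ (effAction C̃_g V_N) Y‖ ≤ 32·e⁹·κ̃²·U·(β/(4M))` — the plain `B̃₀` of `Σ^{res}_0`, an ABSOLUTE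
  constant times `U·β/N`.

The first-moment twin `B̃₁` is §1 at `α̃_w = 2α_w` once (E4)₀'s `α_w` is a closed term.  Everything is proved; no definitions, no named facts,
no sorry.  `--supports stmt-HubbardSuperconductivity-20236` (helper).
-/

noncomputable section

namespace Summit.HubbardSuperconductivity.HubbardSuperconductivity.Theorems.EngineV8

set_option linter.dupNamespace false -- summit = problem name (single-conjunct summit), D-0017

open Real Finset Literature.MathematicalPhysics.QuantumLattice Literature.Probability.LatticeModels
open Literature.Probability.LatticeModels.BattleFederbush GrassmannAlgebra
open Summit.HubbardSuperconductivity.HubbardSuperconductivity.Theorems.KLRegimeSplit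
open Summit.HubbardSuperconductivity.HubbardSuperconductivity.Theorems.KLProgrammeLegKernels
open Summit.HubbardSuperconductivity.HubbardSuperconductivity.Theorems.ScaleZeroDecay

variable {L N : ℕ} [NeZero L]

/-! ## §0 The quartic-only profile -/

/-- The pinned profile of the grid quartic vertex ALONE: `N(2) = |U||β|/N`, all other degrees `0`. -/
theorem sum_norm_kernel_hubbardGridInteraction_pinned_le (β U : ℝ) (m' : ℕ) (j : Fin (2 * m')) (w : GridLeg (GridPoint L N)) :
    ∑ Y ∈ univ.filter (fun Y : Fin (2 * m') → GridLeg (GridPoint L N) => Y j = w),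
        ‖kernel ℂ (hubbardGridInteraction L N β U) (2 * m') Y‖ ≤ (if m' = 2 then |U| * |β| / N else 0) := by
  by_cases hm : m' = 2
  · subst hm
    rw [if_pos rfl]
    exact sum_norm_kernel_hubbardGridInteraction_le β U j w
  · rw [if_neg hm]
    refine (sum_eq_zero fun Y _ => ?_).le
    rw [kernel_hubbardGridInteraction_of_ne β U (by omega) Y, norm_zero]

/-- The weighted pinned profile of the grid quartic vertex ALONE, for any weight equal to `1` on its support (hypothesis `hwt1`). -/
theorem sum_norm_kernel_hubbardGridInteraction_pinned_wt_le (β U : ℝ) (wt : Finset (GridLeg (GridPoint L N)) → ℝ)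
    (hwt1 : ∀ X : Fin 4 → GridLeg (GridPoint L N), kernel ℂ (hubbardGridInteraction L N β U) 4 X ≠ 0 → wt (univ.image X) = 1)
    (m' : ℕ) (j : Fin (2 * m')) (w : GridLeg (GridPoint L N)) :
    ∑ Y ∈ univ.filter (fun Y : Fin (2 * m') → GridLeg (GridPoint L N) => Y j = w),
        ‖kernel ℂ (hubbardGridInteraction L N β U) (2 * m') Y‖ * wt (univ.image Y) ≤ (if m' = 2 then |U| * |β| / N else 0) := by
  by_cases hm : m' = 2
  · subst hm
    rw [if_pos rfl]
    refine le_trans (sum_le_sum fun Y _ => ?_) (sum_norm_kernel_hubbardGridInteraction_le β U j w)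
    by_cases hY : kernel ℂ (hubbardGridInteraction L N β U) 4 Y = 0
    · have hY' : kernel ℂ (hubbardGridInteraction L N β U) (2 * 2) Y = 0 := hY
      rw [hY', norm_zero, zero_mul]
    · have h1 : wt (univ.image Y) = 1 := hwt1 Y hY
      rw [h1, mul_one]
  · rw [if_neg hm]
    refine (sum_eq_zero fun Y _ => ?_).le
    rw [kernel_hubbardGridInteraction_of_ne β U (by omega) Y, norm_zero, zero_mul]

/-- `0 ≤` the quartic-only profile. -/
theorem quarticProfile_nonneg (β U : ℝ) (N : ℕ) (m' : ℕ) : 0 ≤ (if m' = 2 then |U| * |β| / N else 0 : ℝ) := by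
  split_ifs <;> positivity

/-- **`‖V_N‖_h` of the quartic-only profile**: `normV Γ κ ρ N_q ≤ (e²(κ+ρ))⁴·|U||β|/N`. -/
theorem normV_quarticProfile_le (Γ : Type*) [Fintype Γ] (κ ρ : ℝ) (β U : ℝ) (N : ℕ) :
    normV Γ κ ρ (fun m' => if m' = 2 then |U| * |β| / N else 0) ≤ (Real.exp 2 * (κ + ρ)) ^ 4 * (|U| * |β| / N) := by
  rw [normV]
  have hterm : ∀ m' ∈ range (Fintype.card Γ / 2 + 1),
      (Real.exp 2 * (κ + ρ)) ^ (2 * m') * (if m' = 2 then |U| * |β| / N else 0 : ℝ) =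
        if m' = 2 then (Real.exp 2 * (κ + ρ)) ^ 4 * (|U| * |β| / N) else 0 := by
    intro m' _
    split_ifs with h
    · subst h; norm_num
    · rw [mul_zero]
  rw [sum_congr rfl hterm, sum_ite_eq']
  split_ifs
  · exact le_rfl
  · positivity

/-! ## §1 The two-leg grid sums of `effAction C V_N` for ANY grid covariance `C` -/

/-- **THE PLAIN TWO-LEG SUM OF THE K-RESUMMED STEP** (`B̃₀`, any `C`): with `C` replica-Gram-bounded (`κ`), plain row/column sums `≤ α`,
the quartic-only profile, `θ = eα‖V_N‖_h/κ² < 1`:  `Σ_{Y : Y 0 = w} ‖kernel₂ (effAction C V_N) Y‖ ≤ ρ⁻²·e‖V_N‖_h/(1 − θ)`. -/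
theorem resummedTwoLeg_plain_sum_le_of_gridStep (C : Matrix (GridLeg (GridPoint L N)) (GridLeg (GridPoint L N)) ℂ) (β U : ℝ)
    {κ : ℝ} (hκ : 0 < κ) (hGB : IsGramBoundedR C κ)
    {α : ℝ} (hα : 0 < α) (hrow : ∀ X, ∑ Y, ‖C X Y‖ ≤ α) (hcol : ∀ Y, ∑ X, ‖C X Y‖ ≤ α) {ρ : ℝ} (hρ : 0 < ρ)
    (hθ : Real.exp 1 * α * normV (GridLeg (GridPoint L N)) κ ρ (fun m' => if m' = 2 then |U| * |β| / N else 0) / κ ^ 2 < 1)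
    (w : GridLeg (GridPoint L N)) :
    ∑ Y ∈ univ.filter (fun Y : Fin 2 → GridLeg (GridPoint L N) => Y 0 = w),
        ‖kernel ℂ (effAction ℂ C (hubbardGridInteraction L N β U)) 2 Y‖ ≤
      ρ⁻¹ ^ 2 * (Real.exp 1 * normV (GridLeg (GridPoint L N)) κ ρ (fun m' => if m' = 2 then |U| * |β| / N else 0)) /
        (1 - Real.exp 1 * α * normV (GridLeg (GridPoint L N)) κ ρ (fun m' => if m' = 2 then |U| * |β| / N else 0) / κ ^ 2) := by
  obtain ⟨-, hfull⟩ := sum_norm_kernel_effAction_le_of_gramBounded C hκ hGB (hubbardGridInteraction L N β U)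
    (hubbardGridInteraction_mem_evenPart β U) (constPart_hubbardGridInteraction β U) _ (quarticProfile_nonneg β U N)
    (sum_norm_kernel_hubbardGridInteraction_pinned_le β U) hα hrow hcol hρ hθ
  exact hfull (m := 2) two_pos 0 w

/-- **THE WEIGHTED OFF-DIAGONAL TWO-LEG SUMS OF THE K-RESUMMED STEP** (any `C`): `wt` a tree weight with `C` replica-Gram-bounded (`κ`),
`wt`-pair-weighted row/column sums `≤ α_w`, the `wt`-weighted quartic profile `N_w`, output weight `ρ`, `θ_w = eα_w‖V_N‖_{h,wt}/κ² < 1`;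
`ω` a pair weight vanishing when both legs sit at one grid point and `≤ c·wt` (`c ≥ 0`).  Then
`Σ_{Y : Y 0 = w} ω(Y)·‖kernel₂ (effAction C V_N) Y‖ ≤ c·(ρ⁻²·e‖V_N‖_{h,wt}·θ_w/(1−θ_w))` — off the diagonal the tadpole `e^{Δ_C} V_N` has no
two-leg kernel, so the two-leg kernel there is the TRUNCATED step's. -/
theorem resummedTwoLeg_offDiag_wsum_le_of_wgridStep (C : Matrix (GridLeg (GridPoint L N)) (GridLeg (GridPoint L N)) ℂ) (β U : ℝ)
    {wt : Finset (GridLeg (GridPoint L N)) → ℝ} (hwt : IsTreeWeight wt) {κ : ℝ} (hκ : 0 < κ) (hGB : IsGramBoundedR C κ)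
    (Nw : ℕ → ℝ) (hNw0 : ∀ m', 0 ≤ Nw m')
    (hNw : ∀ m' (j : Fin (2 * m')) (w : GridLeg (GridPoint L N)),
      ∑ Y ∈ univ.filter (fun Y : Fin (2 * m') → GridLeg (GridPoint L N) => Y j = w),
        ‖kernel ℂ (hubbardGridInteraction L N β U) (2 * m') Y‖ * wt (univ.image Y) ≤ Nw m')
    {αw : ℝ} (hαw : 0 < αw) (hrow : ∀ X, ∑ Y, ‖C X Y‖ * wt {X, Y} ≤ αw) (hcol : ∀ Y, ∑ X, ‖C X Y‖ * wt {X, Y} ≤ αw)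
    {ρ : ℝ} (hρ : 0 < ρ) (hθ : Real.exp 1 * αw * normV (GridLeg (GridPoint L N)) κ ρ Nw / κ ^ 2 < 1)
    (ω : (Fin 2 → GridLeg (GridPoint L N)) → ℝ) (hωdiag : ∀ Y, (Y 0).1.1 = (Y 1).1.1 → ω Y = 0)
    {c : ℝ} (hc : 0 ≤ c) (hωle : ∀ Y, ω Y ≤ c * wt (univ.image Y)) (w : GridLeg (GridPoint L N)) :
    ∑ Y ∈ univ.filter (fun Y : Fin 2 → GridLeg (GridPoint L N) => Y 0 = w),
        ω Y * ‖kernel ℂ (effAction ℂ C (hubbardGridInteraction L N β U)) 2 Y‖ ≤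
      c * (ρ⁻¹ ^ 2 * (Real.exp 1 * normV (GridLeg (GridPoint L N)) κ ρ Nw) *
        (Real.exp 1 * αw * normV (GridLeg (GridPoint L N)) κ ρ Nw / κ ^ 2) /
          (1 - Real.exp 1 * αw * normV (GridLeg (GridPoint L N)) κ ρ Nw / κ ^ 2)) := by
  set V := hubbardGridInteraction L N β U with hV
  obtain ⟨-, htr⟩ := sum_wt_norm_kernel_effAction_sub_gaussConv_le_of_gramBounded C hwt hκ hGB V
    (hubbardGridInteraction_mem_evenPart β U) (constPart_hubbardGridInteraction β U) Nw hNw0 hNw hαw hrow hcol hρ hθ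
  have h2 := htr (m := 2) two_pos 0 w
  -- termwise: off the diagonal the kernel is the truncated one; on the diagonal the weight vanishes
  have hpt : ∀ Y : Fin 2 → GridLeg (GridPoint L N),
      ω Y * ‖kernel ℂ (effAction ℂ C V) 2 Y‖ ≤ c * (wt (univ.image Y) * ‖kernel ℂ (effAction ℂ C V - gaussConv ℂ C V) 2 Y‖) := by
    intro Y
    by_cases hY : (Y 0).1.1 = (Y 1).1.1
    · rw [hωdiag Y hY, zero_mul]
      exact mul_nonneg hc (mul_nonneg (hwt.nonneg _) (norm_nonneg _))
    · have hker : kernel ℂ (effAction ℂ C V) 2 Y = kernel ℂ (effAction ℂ C V - gaussConv ℂ C V) 2 Y := by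
        rw [kernel_sub_apply, hV, kernel_two_gaussConv_hubbardGridInteraction_eq_zero_of_ne C β U Y hY, sub_zero]
      rw [hker, ← mul_assoc]
      exact mul_le_mul_of_nonneg_right (hωle Y) (norm_nonneg _)
  calc ∑ Y ∈ univ.filter (fun Y : Fin 2 → GridLeg (GridPoint L N) => Y 0 = w), ω Y * ‖kernel ℂ (effAction ℂ C V) 2 Y‖
      ≤ ∑ Y ∈ univ.filter (fun Y : Fin 2 → GridLeg (GridPoint L N) => Y 0 = w),
          c * (wt (univ.image Y) * ‖kernel ℂ (effAction ℂ C V - gaussConv ℂ C V) 2 Y‖) := sum_le_sum fun Y _ => hpt Y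
    _ = c * ∑ Y ∈ univ.filter (fun Y : Fin 2 → GridLeg (GridPoint L N) => Y 0 = w),
          wt (univ.image Y) * ‖kernel ℂ (effAction ℂ C V - gaussConv ℂ C V) 2 Y‖ := by rw [mul_sum]
    _ ≤ _ := mul_le_mul_of_nonneg_left h2 hc

/-! ## §2 At the engine's package: the plain two-leg sum of `Σ^{res}_0` BY NAME -/

section KlEng

variable {M : ℕ} [NeZero M] {P : SplitConsts} {R : RenConsts} {c U β μ : ℝ} {Nsc : ℕ} {K : TrigPolyC4v}

/-- `klEngL₃ β U ≤ L ⇒ 2^15 ≤ L` for `klBetaMin ≤ β` (`klEngL₃ = 2^{10}(⌈|β|⌉+1)²(⌈|U|⁻¹⌉+1)² ≥ 2^{10}·129²`). -/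
theorem two_pow_fifteen_le_of_klEngL₃_le (hβ : klBetaMin ≤ β) {L : ℕ} (hL : klEngL₃ β U ≤ L) : (2 : ℝ) ^ 15 ≤ L := by
  have hβ128 : (128 : ℝ) ≤ β := by simpa [klBetaMin] using hβ
  have h3 : ((2 ^ 10 * (⌈|β|⌉₊ + 1) ^ 2 * (⌈|U|⁻¹⌉₊ + 1) ^ 2 : ℕ) : ℝ) ≤ (L : ℝ) := by
    have : klEngL₃ β U ≤ L := hL
    unfold klEngL₃ at this
    exact_mod_cast this
  push_cast at h3
  have hc : (128 : ℝ) ≤ (⌈|β|⌉₊ : ℝ) := by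
    have h2 : |β| ≤ (⌈|β|⌉₊ : ℝ) := Nat.le_ceil _
    have h1 : β ≤ |β| := le_abs_self β
    linarith
  have hu : (1 : ℝ) ≤ ((⌈|U|⁻¹⌉₊ : ℝ) + 1) ^ 2 := by
    have : (0 : ℝ) ≤ (⌈|U|⁻¹⌉₊ : ℝ) := Nat.cast_nonneg _
    nlinarith
  nlinarith [hc, hu, sq_nonneg ((⌈|β|⌉₊ : ℝ) + 1)]

/-- The frame's sup size is within the resummation regime below the engine threshold: `R.WF`, `0 < U ≤ klEngU₀3 P R c ⇒ (16/15)·Gfr0·|U| ≤ klE0/4`. -/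
theorem gfr0_abs_mul_le_of_klEngU₀3 (hR : R.WF) (hU : 0 < U) (hU₀ : U ≤ klEngU₀3 P R c) : 16 / 15 * (R.Gfr 0 * |U|) ≤ klE0 / 4 := by
  have hG := hR.2.2
  have hG0 : R.Gfr 0 ≤ klEngRsq R := gfr_le_klEngRsq R (by norm_num)
  have hRsq1 : 1 ≤ klEngRsq R := one_le_klEngRsq R
  have hU1 : U ≤ 1 / (2 : ℝ) ^ 120 := hU₀.trans (klEngU₀3_le_two_pow P R c)
  have hPsq1 : 1 ≤ klEngPsq P := one_le_klEngPsq P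
  -- `Gfr0 · U ≤ Rsq / (2^120 Rsq^4) ≤ 2^{-120}`
  have hden : (2 : ℝ) ^ 120 * klEngRsq R ≤ (2 : ℝ) ^ 120 * klEngPsq P ^ 2 * klEngRsq R ^ 4 * (c ^ 2 + 1) := by
    have h2' : (1 : ℝ) ≤ klEngPsq P ^ 2 := one_le_pow₀ hPsq1
    have h3 : (1 : ℝ) ≤ c ^ 2 + 1 := by nlinarith [sq_nonneg c]
    have h4 : klEngRsq R ≤ klEngRsq R ^ 4 := le_self_pow₀ hRsq1 (by norm_num)
    have hR0 : 0 ≤ klEngRsq R := by linarith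
    calc (2 : ℝ) ^ 120 * klEngRsq R = (2 : ℝ) ^ 120 * 1 * klEngRsq R * 1 := by ring
      _ ≤ (2 : ℝ) ^ 120 * klEngPsq P ^ 2 * klEngRsq R ^ 4 * (c ^ 2 + 1) := by gcongr
  have hUle : U ≤ 1 / ((2 : ℝ) ^ 120 * klEngRsq R) := by
    refine hU₀.trans ?_
    rw [klEngU₀3]
    exact one_div_le_one_div_of_le (by positivity) hden
  rw [abs_of_pos hU]
  have hGU : R.Gfr 0 * U ≤ klEngRsq R * (1 / ((2 : ℝ) ^ 120 * klEngRsq R)) := mul_le_mul hG0 hUle hU.le (by linarith)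
  have hsimp : klEngRsq R * (1 / ((2 : ℝ) ^ 120 * klEngRsq R)) = 1 / (2 : ℝ) ^ 120 := by
    field_simp
  rw [hsimp] at hGU
  rw [klE0]
  nlinarith

/-- **The smallness of the K-resummed scale-`0` step at the package**: `θ̃ = e·α̃·‖V_N‖_h/κ̃² ≤ 1/2` with `κ = ρ = κ̃ = √(2(7 + (2·1606732 + 5/4)))`,
`α̃ = 2·(N/β)·klScaleZeroA0`, `‖V_N‖_h ≤ (2e²κ̃)⁴·U·β/N`, for `0 < U ≤ klEngU₀3 P R c`, `0 < β` (`θ̃ ≤ 32e⁹κ̃²·A0·U ≤ 2^86·U ≤ 2^{-34}`). -/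
theorem resummedTheta_scaleZero_le_half (hβ0 : 0 < β) (hU : 0 < U) (hU₀ : U ≤ klEngU₀3 P R c) (Ng : ℕ) [NeZero Ng] :
    Real.exp 1 * (2 * ((Ng : ℝ) / β * klScaleZeroA0)) *
        ((Real.exp 2 * (Real.sqrt (2 * (7 + (2 * 1606732 + 5 / 4))) + Real.sqrt (2 * (7 + (2 * 1606732 + 5 / 4))))) ^ 4 *
          (|U| * |β| / Ng)) / Real.sqrt (2 * (7 + (2 * 1606732 + 5 / 4))) ^ 2 ≤ 1 / 2 := by
  set kk : ℝ := Real.sqrt (2 * (7 + (2 * 1606732 + 5 / 4))) with hkk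
  have hkk2 : kk ^ 2 = 2 * (7 + (2 * 1606732 + 5 / 4)) := by rw [hkk, Real.sq_sqrt (by norm_num)]
  have hkkpos : 0 < kk := by rw [hkk]; positivity
  have hNg : 0 < (Ng : ℝ) := by have := NeZero.ne Ng; positivity
  have hA := klScaleZeroA0_le_two_pow
  have hA0 := klScaleZeroA0_pos.le
  have he1 : Real.exp 1 ≤ 3 := by have := Real.exp_one_lt_d9; linarith
  have he0 : 0 ≤ Real.exp 1 := (Real.exp_pos 1).le
  have he2 : Real.exp 2 = Real.exp 1 ^ 2 := by rw [← Real.exp_nat_mul]; norm_num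
  have hU1 : U ≤ 1 / (2 : ℝ) ^ 120 := hU₀.trans (klEngU₀3_le_two_pow P R c)
  rw [abs_of_pos hU, abs_of_pos hβ0]
  -- rewrite the left side as `32 · e^9 · kk^2 · A0 · U`
  have hlhs : Real.exp 1 * (2 * ((Ng : ℝ) / β * klScaleZeroA0)) * ((Real.exp 2 * (kk + kk)) ^ 4 * (U * β / Ng)) / kk ^ 2 =
      32 * Real.exp 1 ^ 9 * kk ^ 2 * klScaleZeroA0 * U := by
    rw [he2]
    field_simp
    ring
  rw [hlhs]
  have he9 : Real.exp 1 ^ 9 ≤ (3 : ℝ) ^ 9 := pow_le_pow_left₀ he0 he1 9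
  have hk23 : kk ^ 2 ≤ (2 : ℝ) ^ 23 := by rw [hkk2]; norm_num
  calc 32 * Real.exp 1 ^ 9 * kk ^ 2 * klScaleZeroA0 * U
      ≤ 32 * (3 : ℝ) ^ 9 * (2 : ℝ) ^ 23 * (2 : ℝ) ^ 43 * (1 / (2 : ℝ) ^ 120) := by
        have h1 : 0 ≤ Real.exp 1 ^ 9 := by positivity
        have h2 : 0 ≤ kk ^ 2 := by positivity
        gcongr
    _ ≤ 1 / 2 := by norm_num

/-- **THE PLAIN TWO-LEG SUM OF `Σ^{res}_0` AT THE ENGINE'S PACKAGE, BY NAME.**  Under the binders of `stub_twoLeg_scale0` (`FrameOK R U Nsc μ K`,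
`R.WF`, `klBetaMin ≤ β`, `0 < U ≤ klEngU₀3 P R c`, `klEngL₃ β U ≤ L`, `klEngM₃ β U L ≤ M`), for k3c5-p1's K-resummed scale-`0` covariance
`C̃_g = S_Nᵀ·normalCovariance Ψ̃·S_N` on the `N = 4M` grid and every pinned leg `w`:
`Σ_{Y : Y 0 = w} ‖kernel₂ (effAction C̃_g V_N) Y‖ ≤ 32·e⁹·κ̃²·U·(β/N)`, `κ̃² = 2(7 + (2·1606732 + 5/4))`. -/
theorem resummedTwoLeg_plain_sum_scaleZero_le_of_klEng {L : ℕ} [NeZero L] (hR : R.WF) (hK : FrameOK R U Nsc μ K) (hβ : klBetaMin ≤ β)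
    (hU : 0 < U) (hU₀ : U ≤ klEngU₀3 P R c) (hL : klEngL₃ β U ≤ L) (hM : klEngM₃ β U L ≤ M)
    (w : GridLeg (GridPoint L (2 * (2 * M)))) :
    ∑ Y ∈ univ.filter (fun Y : Fin 2 → GridLeg (GridPoint L (2 * (2 * M))) => Y 0 = w),
        ‖kernel ℂ (effAction ℂ ((hubbardGridSub L M β (2 * (2 * M))).transpose *
            normalCovariance L M (fun ks => uvSymbolCT L M β μ K klE0 ks /
              (1 + uvSymbolCT L M β μ K klE0 ks * ((K.eval (latticeMomentum L ks.1.2) / (β * (L : ℝ) ^ 2) : ℝ) : ℂ))) *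
            hubbardGridSub L M β (2 * (2 * M))) (hubbardGridInteraction L (2 * (2 * M)) β U)) 2 Y‖ ≤
      32 * Real.exp 1 ^ 9 * (2 * (7 + (2 * 1606732 + 5 / 4))) * U * (β / (((2 * (2 * M) : ℕ) : ℝ))) := by
  haveI : NeZero (2 * (2 * M)) := ⟨by have := NeZero.ne M; omega⟩
  have hβ0 : 0 < β := beta_pos_of_klBetaMin_le hβ
  have hG := hR.2.2
  have hβL : β ≤ L := le_of_klEngL₃_le hL
  have hL15 := two_pow_fifteen_le_of_klEngL₃_le hβ hL
  have hβM := pow_three_le_of_klEng hβ hL hM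
  have hNg : 0 < (((2 * (2 * M) : ℕ) : ℝ)) := by have := NeZero.ne M; positivity
  set kk : ℝ := Real.sqrt (2 * (7 + (2 * 1606732 + 5 / 4))) with hkk
  have hkk2 : kk ^ 2 = 2 * (7 + (2 * 1606732 + 5 / 4)) := by rw [hkk, Real.sq_sqrt (by norm_num)]
  have hkkpos : 0 < kk := by rw [hkk]; positivity
  -- the two covariance inputs by name
  have hGB := isGramBoundedR_scaleZero_resummed_of_frameOK (M := M) hK hG (gfr0_abs_mul_le_of_klEngU₀3 hR hU hU₀) hβ hL15 hβL
  have hden := fun ks => one_add_uvSymbolCT_mul_ne_zero (L := L) (M := M) hβ0 μ K klE0 ks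
  have hrow := fun X => rowSum_gridSub_resummedNormalCov_le_of_klEng (μ := μ) hR hK hβ hβM hU hU₀ hden X
  have hcol := fun Y => colSum_gridSub_resummedNormalCov_le_of_klEng (μ := μ) hR hK hβ hβM hU hU₀ hden Y
  have hA0 := klScaleZeroA0_pos
  have hαpos : 0 < 2 * ((((2 * (2 * M) : ℕ) : ℝ)) / β * klScaleZeroA0) := by positivity
  -- smallness
  have hθ := resummedTheta_scaleZero_le_half (P := P) (R := R) (c := c) hβ0 hU hU₀ (2 * (2 * M))
  have hnV := normV_quarticProfile_le (GridLeg (GridPoint L (2 * (2 * M)))) kk kk β U (2 * (2 * M))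
  have hnV0 : 0 ≤ normV (GridLeg (GridPoint L (2 * (2 * M)))) kk kk (fun m' => if m' = 2 then |U| * |β| / (((2 * (2 * M) : ℕ) : ℝ)) else 0) :=
    normV_nonneg hkkpos.le hkkpos.le (quarticProfile_nonneg β U (2 * (2 * M)))
  have hθ' : Real.exp 1 * (2 * ((((2 * (2 * M) : ℕ) : ℝ)) / β * klScaleZeroA0)) *
      normV (GridLeg (GridPoint L (2 * (2 * M)))) kk kk (fun m' => if m' = 2 then |U| * |β| / (((2 * (2 * M) : ℕ) : ℝ)) else 0) / kk ^ 2 ≤ 1 / 2 := by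
    refine le_trans ?_ hθ
    have he0 : 0 ≤ Real.exp 1 := (Real.exp_pos 1).le
    gcongr
  have hθlt : Real.exp 1 * (2 * ((((2 * (2 * M) : ℕ) : ℝ)) / β * klScaleZeroA0)) *
      normV (GridLeg (GridPoint L (2 * (2 * M)))) kk kk (fun m' => if m' = 2 then |U| * |β| / (((2 * (2 * M) : ℕ) : ℝ)) else 0) / kk ^ 2 < 1 := by
    linarith
  have h := resummedTwoLeg_plain_sum_le_of_gridStep _ β U hkkpos hGB hαpos hrow hcol hkkpos hθlt w
  refine h.trans ?_
  -- `ρ⁻²·e·normV/(1−θ̃) ≤ 2·kk⁻²·e·(2e²kk)⁴·U·β/N = 32 e^9 kk^2 U β/N`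
  have he2 : Real.exp 2 = Real.exp 1 ^ 2 := by rw [← Real.exp_nat_mul]; norm_num
  have hden1 : (1 : ℝ) / 2 ≤ 1 - Real.exp 1 * (2 * ((((2 * (2 * M) : ℕ) : ℝ)) / β * klScaleZeroA0)) *
      normV (GridLeg (GridPoint L (2 * (2 * M)))) kk kk (fun m' => if m' = 2 then |U| * |β| / (((2 * (2 * M) : ℕ) : ℝ)) else 0) / kk ^ 2 := by
    linarith
  have hnum : kk⁻¹ ^ 2 * (Real.exp 1 * normV (GridLeg (GridPoint L (2 * (2 * M)))) kk kk
      (fun m' => if m' = 2 then |U| * |β| / (((2 * (2 * M) : ℕ) : ℝ)) else 0)) ≤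
      kk⁻¹ ^ 2 * (Real.exp 1 * ((Real.exp 2 * (kk + kk)) ^ 4 * (|U| * |β| / (((2 * (2 * M) : ℕ) : ℝ))))) := by
    have he0 : 0 ≤ Real.exp 1 := (Real.exp_pos 1).le
    gcongr
  have hnum0 : 0 ≤ kk⁻¹ ^ 2 * (Real.exp 1 * normV (GridLeg (GridPoint L (2 * (2 * M)))) kk kk
      (fun m' => if m' = 2 then |U| * |β| / (((2 * (2 * M) : ℕ) : ℝ)) else 0)) := by positivity
  calc kk⁻¹ ^ 2 * (Real.exp 1 * normV (GridLeg (GridPoint L (2 * (2 * M)))) kk kk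
        (fun m' => if m' = 2 then |U| * |β| / (((2 * (2 * M) : ℕ) : ℝ)) else 0)) /
        (1 - Real.exp 1 * (2 * ((((2 * (2 * M) : ℕ) : ℝ)) / β * klScaleZeroA0)) *
          normV (GridLeg (GridPoint L (2 * (2 * M)))) kk kk (fun m' => if m' = 2 then |U| * |β| / (((2 * (2 * M) : ℕ) : ℝ)) else 0) / kk ^ 2)
      ≤ kk⁻¹ ^ 2 * (Real.exp 1 * ((Real.exp 2 * (kk + kk)) ^ 4 * (|U| * |β| / (((2 * (2 * M) : ℕ) : ℝ))))) / (1 / 2) :=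
        div_le_div₀ (hnum0.trans hnum) hnum (by norm_num) hden1
    _ = 32 * Real.exp 1 ^ 9 * (2 * (7 + (2 * 1606732 + 5 / 4))) * U * (β / (((2 * (2 * M) : ℕ) : ℝ))) := by
        rw [abs_of_pos hU, abs_of_pos hβ0, he2, ← hkk2]
        field_simp
        ring

end KlEng

end Summit.HubbardSuperconductivity.HubbardSuperconductivity.Theorems.EngineV8

end
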